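import Mathlib
import HarnessLib

/-!
# Algebraic cores of Theorem J (no pointwise function of `∇u` has a maximum principle in 3D)

Soloist (blind) report `sharpest.md` v15 §2.7.

*Theorem J.* For every positively homogeneous `q : sl(3,ℝ) → ℝ` (C¹ near its spherical maximiser, or convex, positive
somewhere) and every `ν ≥ 0` there is a smooth compactly supported divergence-free datum along whose Euler/Navier–Stokes
solution `sup_x q(∇u)` strictly increases for small times.  The proof rests on *Lemma H* (at a global maximum of `|∇u|`
the traceless pressure Hessian is kinematically free), whose core field is `U_A = ∇ × (e^{-|x|²/2} P_A)`,
`P_A(x) = -⅓ x × (Ax)`, with the certified gradient envelope `|∇U_A(x)|² ≤ Λ(|x|²)|A|²`,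
`Λ(s) = e^{-s} max{(1-s/3)², (1-s)², λ₊(s)}`, `λ₊(s) = 1 - 2s + φ(s) + √(s²/9 + (φ(s)-2s)²)`,
`φ(s) = s²(43 - 12s + s²)/18`, and on the stretching commutator in the rotation-maximiser case.
This file certifies the finite-dimensional algebra and the one-variable inequalities:
* `crossMat_mul_symm_add` — `[ω]ₓ S + S [ω]ₓ = (tr S)[ω]ₓ - [Sω]ₓ` for symmetric `S` (vortex stretching as a commutator);
* `sq_sub_transpose_sq` — for `A = [ω]ₓ + S`, `A² - (A²)ᵀ = 2([ω]ₓ S + S [ω]ₓ)`: the antisymmetric part of `-A²` is `[Sω]ₓ - (tr S)[ω]ₓ`;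
* `crossMat_inner_sq` — `⟨[ω]ₓ, [ω]ₓ²⟩ = 0` (a rotation maximiser gains nothing from the local self-term);
* `axialStrain_commutator` — with `S = μ·diag(-½,-½,1)` and `ω ∥ e₃`: `[ω]ₓ S + S [ω]ₓ = -μ [ω]ₓ` (Step 3 of the proof);
* `curl_cross_linear`, `div_coreField` — the polynomial identities `∇ × (x × (Ax)) = (tr A)x - 3Ax` and
  `div W_A = x · W_A` for `W_A = (3 - |x|²)Ax + (xᵀAx)x`, `tr A = 0` (so `U_A = ⅓ e^{-|x|²/2} W_A` is divergence-free);
* `twoByTwo_topEig_le` — the Gershgorin step `(a+d)/2 + √(((a-d)/2)² + b²) ≤ a + |b|` for `d ≤ a`;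
* `channel₁_lt_exp`, `channel₂_lt_exp`, `blockChannel_lt_exp`, `gradEnvelope_lt_one` — the three channels of `Λ`
  are `< e^{s}` for `s > 0`, hence `Λ(s) < 1`: the origin is the strict global maximiser of `|∇U_A|`.
The analysis (the Calderón–Zygmund representation of the pressure Hessian, the ringlet lemma, local well-posedness)
is proved in the report, not here.

The linter option `linter.dupNamespace` is disabled because the mandated landing namespace repeats the summit name by
design (D-0017). [problem: ns]
-/

set_option linter.dupNamespace false

namespace Summit.NavierStokesRegularity.NavierStokesRegularity.Theorems

open Matrix

/-! ### Matrix algebra of the velocity gradient -/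

/-- The cross-product matrix `[ω]ₓ`, `[ω]ₓ v = ω × v`. -/
def crossMat (ω : Fin 3 → ℝ) : Matrix (Fin 3) (Fin 3) ℝ :=
  !![0, -ω 2, ω 1; ω 2, 0, -ω 0; -ω 1, ω 0, 0]

/-- A general symmetric `3 × 3` matrix. -/
def symMat (a b c d e f : ℝ) : Matrix (Fin 3) (Fin 3) ℝ :=
  !![a, d, e; d, b, f; e, f, c]

/-- `[ω]ₓ` acts as the cross product. -/
theorem crossMat_mulVec (ω v : Fin 3 → ℝ) :
    (crossMat ω).mulVec v = ![ω 1 * v 2 - ω 2 * v 1, ω 2 * v 0 - ω 0 * v 2, ω 0 * v 1 - ω 1 * v 0] := by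
  ext i
  fin_cases i <;> simp [crossMat, Matrix.mulVec, dotProduct, Fin.sum_univ_three] <;> ring

/-- VORTEX STRETCHING AS A COMMUTATOR: for symmetric `S`, `[ω]ₓ S + S [ω]ₓ = (tr S) [ω]ₓ - [S ω]ₓ`.
In 3D the right-hand side contains `[Sω]ₓ`; for `2 × 2` matrices the analogous sum is `(tr S)[ω]` only. -/
theorem crossMat_mul_symm_add (ω : Fin 3 → ℝ) (a b c d e f : ℝ) :
    crossMat ω * symMat a b c d e f + symMat a b c d e f * crossMat ω
      = (a + b + c) • crossMat ω - crossMat ((symMat a b c d e f).mulVec ω) := by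
  ext i j
  fin_cases i <;> fin_cases j <;>
    simp [crossMat, symMat, Matrix.mulVec, dotProduct, Fin.sum_univ_three] <;> ring

/-- For `A = [ω]ₓ + S` (`S` symmetric) the antisymmetric part of `A²` is `[ω]ₓ S + S [ω]ₓ`:
`A² - (A²)ᵀ = 2([ω]ₓ S + S [ω]ₓ)`.  With `crossMat_mul_symm_add`: the inviscid, pressure-free rate of the rotation
part of `∇u` at a point with `∇u = [ω]ₓ + S` is `[Sω]ₓ - (tr S)[ω]ₓ`. -/
theorem sq_sub_transpose_sq (ω : Fin 3 → ℝ) (a b c d e f : ℝ) :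
    let A := crossMat ω + symMat a b c d e f
    A * A - (A * A)ᵀ = (2 : ℝ) • (crossMat ω * symMat a b c d e f + symMat a b c d e f * crossMat ω) := by
  ext i j
  fin_cases i <;> fin_cases j <;> simp [crossMat, symMat] <;> ring

/-- A pure rotation gains nothing from the local self-interaction term: `⟨[ω]ₓ, [ω]ₓ²⟩_F = tr([ω]ₓᵀ [ω]ₓ²) = 0`. -/
theorem crossMat_inner_sq (ω : Fin 3 → ℝ) :
    Matrix.trace ((crossMat ω)ᵀ * (crossMat ω * crossMat ω)) = 0 := by
  simp [crossMat, Matrix.trace, Matrix.mul_apply, Fin.sum_univ_three]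
  ring

/-- The symmetric part of `[ω]ₓ S + S [ω]ₓ` vanishes (it is antisymmetric), so prescribing the traceless pressure
Hessian `H° = -(sym A²)°` makes the full inviscid rate of `∇u` antisymmetric. -/
theorem crossMat_mul_symm_add_transpose (ω : Fin 3 → ℝ) (a b c d e f : ℝ) :
    (crossMat ω * symMat a b c d e f + symMat a b c d e f * crossMat ω)ᵀ
      = -(crossMat ω * symMat a b c d e f + symMat a b c d e f * crossMat ω) := by
  ext i j
  fin_cases i <;> fin_cases j <;> simp [crossMat, symMat] <;> ring

/-- STEP 3 OF THEOREM J: vorticity along `e₃` of strength `κ`, axial strain `S = μ·diag(-½,-½,1)` (eigenvalue `μ` on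
the vorticity axis, traceless).  Then `[ω]ₓ S + S [ω]ₓ = -μ [ω]ₓ`, i.e. the rotation part of `-A²` is `+μ [ω]ₓ`:
the rotation component grows at rate `μ` — the first-order gain used when the spherical maximiser of `q` is a rotation. -/
theorem axialStrain_commutator (κ μ : ℝ) :
    crossMat ![0, 0, κ] * symMat (-μ / 2) (-μ / 2) μ 0 0 0 + symMat (-μ / 2) (-μ / 2) μ 0 0 0 * crossMat ![0, 0, κ]
      = (-μ) • crossMat ![0, 0, κ] := by
  ext i j
  fin_cases i <;> fin_cases j <;> simp [crossMat, symMat] <;> ring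

/-- The axial strain is orthogonal to the rotation and has Frobenius norm² `3μ²/2` (so `|A(0)|² = 2κ² + 3μ²/2`). -/
theorem axialStrain_normSq (κ μ : ℝ) :
    Matrix.trace ((symMat (-μ / 2) (-μ / 2) μ 0 0 0)ᵀ * symMat (-μ / 2) (-μ / 2) μ 0 0 0) = 3 * μ ^ 2 / 2 ∧
    Matrix.trace ((crossMat ![0, 0, κ])ᵀ * symMat (-μ / 2) (-μ / 2) μ 0 0 0) = 0 ∧
    Matrix.trace ((crossMat ![0, 0, κ])ᵀ * crossMat ![0, 0, κ]) = 2 * κ ^ 2 := by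
  refine ⟨?_, ?_, ?_⟩ <;>
    simp [crossMat, symMat, Matrix.trace, Matrix.mul_apply, Fin.sum_univ_three] <;> ring

/-! ### The core field `U_A = ∇ × (e^{-|x|²/2} P_A)`, `P_A = -⅓ x × (Ax)`: polynomial identities -/

section corefield

open MvPolynomial

/-- Coordinates `x₀, x₁, x₂` as polynomials. -/
noncomputable abbrev xv (i : Fin 3) : MvPolynomial (Fin 3) ℝ := X i

/-- The linear field `(Ax)_i = Σ_j A_ij x_j` as polynomials. -/
noncomputable def linField (A : Matrix (Fin 3) (Fin 3) ℝ) (i : Fin 3) : MvPolynomial (Fin 3) ℝ :=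
  C (A i 0) * X 0 + C (A i 1) * X 1 + C (A i 2) * X 2

/-- `x × (Ax)` as polynomials. -/
noncomputable def crossLin (A : Matrix (Fin 3) (Fin 3) ℝ) : Fin 3 → MvPolynomial (Fin 3) ℝ :=
  ![X 1 * linField A 2 - X 2 * linField A 1,
    X 2 * linField A 0 - X 0 * linField A 2,
    X 0 * linField A 1 - X 1 * linField A 0]

/-- The curl of a polynomial vector field. -/
noncomputable def pcurl (P : Fin 3 → MvPolynomial (Fin 3) ℝ) : Fin 3 → MvPolynomial (Fin 3) ℝ :=
  ![pderiv 1 (P 2) - pderiv 2 (P 1), pderiv 2 (P 0) - pderiv 0 (P 2), pderiv 0 (P 1) - pderiv 1 (P 0)]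

/-- `∇ × (x × (Ax)) = (tr A) x - 3 Ax`; hence for traceless `A`, `∇ × P_A = Ax` with `P_A = -⅓ x × (Ax)`, and
`U_A = ∇ × (g P_A) = g Ax + ∇g × P_A` has `∇U_A(0) = A`. -/
theorem curl_cross_linear (A : Matrix (Fin 3) (Fin 3) ℝ) (i : Fin 3) :
    pcurl (crossLin A) i = C (A 0 0 + A 1 1 + A 2 2) * X i - 3 * linField A i := by
  fin_cases i <;>
    simp [pcurl, crossLin, linField, Derivation.leibniz, pderiv_X, smul_eq_mul] <;> ring

/-- Three times the polynomial part of the core field: `W_A = (3 - |x|²) Ax + (xᵀAx) x`, so that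
`U_A = ⅓ e^{-|x|²/2} W_A`. -/
noncomputable def coreW (A : Matrix (Fin 3) (Fin 3) ℝ) (i : Fin 3) : MvPolynomial (Fin 3) ℝ :=
  (C (3 : ℝ) - (X 0 ^ 2 + X 1 ^ 2 + X 2 ^ 2)) * linField A i
    + (X 0 * linField A 0 + X 1 * linField A 1 + X 2 * linField A 2) * X i

/-- `div W_A = x · W_A` when `tr A = 0`.  Since `div(g W) = g (div W - x·W)` for `g = e^{-|x|²/2}`, the core field
`U_A = ⅓ g W_A` is divergence-free. -/
theorem div_coreField (A : Matrix (Fin 3) (Fin 3) ℝ) (htr : A 0 0 + A 1 1 + A 2 2 = 0) :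
    pderiv 0 (coreW A 0) + pderiv 1 (coreW A 1) + pderiv 2 (coreW A 2)
      = X 0 * coreW A 0 + X 1 * coreW A 1 + X 2 * coreW A 2 := by
  have h22 : A 2 2 = -(A 0 0 + A 1 1) := by linarith
  have hC : (C (3 : ℝ) : MvPolynomial (Fin 3) ℝ) = 3 := map_ofNat C 3
  simp [coreW, linField, Derivation.leibniz, pderiv_X, smul_eq_mul, h22, map_neg, map_add]
  simp only [hC]
  ring

end corefield

/-! ### The gradient envelope `Λ(s) < 1` for `s > 0` -/

/-- The quartic `φ(s) = s²(43 - 12 s + s²)/18` of the `2 × 2` Gram block. -/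
noncomputable def phiPoly (s : ℝ) : ℝ := s ^ 2 * (43 - 12 * s + s ^ 2) / 18

/-- Top eigenvalue `λ₊(s)` of the `2 × 2` Gram block `[[1 - 5s/3 + φ, ∓(2s - φ)], [∓(2s - φ), 1 - 7s/3 + φ]]`. -/
noncomputable def lambdaPlus (s : ℝ) : ℝ :=
  1 - 2 * s + phiPoly s + Real.sqrt ((s / 3) ^ 2 + (phiPoly s - 2 * s) ^ 2)

/-- The gradient envelope of the core field: `|∇U_A(x)|² ≤ Λ(|x|²) |A|²`, with equality for suitable `A`. -/
noncomputable def gradEnvelope (s : ℝ) : ℝ :=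
  Real.exp (-s) * max (max ((1 - s / 3) ^ 2) ((1 - s) ^ 2)) (lambdaPlus s)

/-- Gershgorin / `2 × 2` step: the top eigenvalue `(a+d)/2 + √(((a-d)/2)² + b²)` of `[[a,b],[b,d]]` with `d ≤ a` is
at most `a + |b|`. -/
theorem twoByTwo_topEig_le (a b d : ℝ) (h : d ≤ a) :
    (a + d) / 2 + Real.sqrt (((a - d) / 2) ^ 2 + b ^ 2) ≤ a + |b| := by
  have hu : 0 ≤ (a - d) / 2 := by linarith
  have hsq : Real.sqrt (((a - d) / 2) ^ 2 + b ^ 2) ≤ (a - d) / 2 + |b| := by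
    rw [Real.sqrt_le_left (by positivity)]
    nlinarith [abs_nonneg b, sq_abs b]
  linarith

/-- Channel `diag(1,-1,0)`, `E₁₂+E₂₁`, rotation about `e₃`: `(1 - s/3)² < e^{s}` for `s > 0`. -/
theorem channel₁_lt_exp (s : ℝ) (hs : 0 < s) : (1 - s / 3) ^ 2 < Real.exp s := by
  have hT : 1 + s + s ^ 2 / 2 ≤ Real.exp s := by
    have := Real.quadratic_le_exp_of_nonneg hs.le
    linarith
  have h1 : (1 - s / 3) ^ 2 = 1 - 2 * s / 3 + s ^ 2 / 9 := by ring
  rw [h1]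
  nlinarith [sq_nonneg s]

/-- Channel `diag(1,1,-2)`: `(1 - s)² < e^{s}` for `s > 0` (via `e^{s} ≥ 1 + s + s²/2 + s³/6`; here via two cases). -/
theorem channel₂_lt_exp (s : ℝ) (hs : 0 < s) : (1 - s) ^ 2 < Real.exp s := by
  have hT : 1 + s + s ^ 2 / 2 ≤ Real.exp s := by
    have := Real.quadratic_le_exp_of_nonneg hs.le
    linarith
  rcases le_or_gt s 4 with h4 | h4
  · nlinarith
  · -- for s > 4 use e^{s} = (e^{s/2})² ≥ (1 + s/2 + s²/8)² > (1-s)²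
    have hT2 : 1 + s / 2 + (s / 2) ^ 2 / 2 ≤ Real.exp (s / 2) := by
      have := Real.quadratic_le_exp_of_nonneg (show 0 ≤ s / 2 by linarith)
      linarith
    have hE : Real.exp s = Real.exp (s / 2) ^ 2 := by
      rw [sq, ← Real.exp_add]; ring_nf
    have hpos : 0 < 1 + s / 2 + (s / 2) ^ 2 / 2 := by positivity
    have h1 : (1 + s / 2 + (s / 2) ^ 2 / 2) ^ 2 ≤ Real.exp (s / 2) ^ 2 := by
      gcongr
    have h2 : (1 - s) ^ 2 < (1 + s / 2 + (s / 2) ^ 2 / 2) ^ 2 := by nlinarith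
    rw [hE]; linarith

/-- The degree-6 Taylor bound `1 + s + s²/2 + s³/6 + s⁴/24 + s⁵/120 + s⁶/720 ≤ e^{s}` for `s ≥ 0`. -/
theorem taylor₆_le_exp (s : ℝ) (hs : 0 ≤ s) :
    1 + s + s ^ 2 / 2 + s ^ 3 / 6 + s ^ 4 / 24 + s ^ 5 / 120 + s ^ 6 / 720 ≤ Real.exp s := by
  have h := Real.sum_le_exp_of_nonneg hs 7
  simp [Finset.sum_range_succ, Nat.factorial] at h
  linarith

/-- The quintic `q₅(s) = 14/3 - (77/18)s + (3/2)s² - (5/72)s³ + s⁴/120 + s⁵/720` is positive on `[0, ∞)`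
(its minimum there is ≈ 1.44; exact Sturm certificate in the report). -/
theorem quintic_pos (s : ℝ) (hs : 0 ≤ s) :
    0 < 14 / 3 - 77 / 18 * s + 3 / 2 * s ^ 2 - 5 / 72 * s ^ 3 + s ^ 4 / 120 + s ^ 5 / 720 := by
  rcases le_or_gt s 6 with h6 | h6
  · -- on [0,6] the cubic part alone is ≥ 1.37
    have hc : 0 < 14 / 3 - 77 / 18 * s + 3 / 2 * s ^ 2 - 5 / 72 * s ^ 3 := by
      nlinarith [sq_nonneg (s - 8 / 5), sq_nonneg (s - 3), mul_nonneg hs (sq_nonneg (s - 8 / 5)),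
        mul_nonneg (sub_nonneg.mpr h6) (sq_nonneg (s - 8 / 5)), mul_nonneg hs (sub_nonneg.mpr h6)]
    have h4 : 0 ≤ s ^ 4 / 120 + s ^ 5 / 720 := by positivity
    linarith
  · -- for s ≥ 6: s⁴/120 + s⁵/720 ≥ s³/10 ≥ 5 s³/72 and 3 s²/2 ≥ 9 s ≥ 77 s/18
    have h1 : 6 * s ^ 3 ≤ s ^ 4 := by nlinarith [pow_pos (show (0:ℝ) < s by linarith) 3]
    have h2 : 36 * s ^ 3 ≤ s ^ 5 := by nlinarith [pow_pos (show (0:ℝ) < s by linarith) 3]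
    have h3 : 6 * s ≤ s ^ 2 := by nlinarith
    nlinarith [pow_pos (show (0:ℝ) < s by linarith) 3]

/-- The `2 × 2` block channel: `1 - 5s/3 + φ(s) + |2s - φ(s)| < e^{s}` for `s > 0`
(`= 1 + s/3` where `φ ≤ 2s`, `= 1 - 11s/3 + 2φ` where `φ > 2s`, and `T₆(s) - (1 - 11s/3 + 2φ(s)) = s·q₅(s) > 0`). -/
theorem blockChannel_lt_exp (s : ℝ) (hs : 0 < s) :
    1 - 5 * s / 3 + phiPoly s + |2 * s - phiPoly s| < Real.exp s := by
  rcases le_or_gt (phiPoly s) (2 * s) with hle | hgt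
  · rw [abs_of_nonneg (by linarith)]
    have h2 : s + 1 < Real.exp s := Real.add_one_lt_exp (ne_of_gt hs)
    linarith
  · rw [abs_of_neg (by linarith)]
    have hT := taylor₆_le_exp s hs.le
    have hq := quintic_pos s hs.le
    have hsq : 0 < s * (14 / 3 - 77 / 18 * s + 3 / 2 * s ^ 2 - 5 / 72 * s ^ 3 + s ^ 4 / 120 + s ^ 5 / 720) :=
      mul_pos hs hq
    unfold phiPoly at *
    nlinarith

/-- `λ₊(s) < e^{s}` for `s > 0`. -/
theorem lambdaPlus_lt_exp (s : ℝ) (hs : 0 < s) : lambdaPlus s < Real.exp s := by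
  have hG := twoByTwo_topEig_le (1 - 5 * s / 3 + phiPoly s) (phiPoly s - 2 * s) (1 - 7 * s / 3 + phiPoly s)
    (by linarith)
  have hB := blockChannel_lt_exp s hs
  have habs : |phiPoly s - 2 * s| = |2 * s - phiPoly s| := abs_sub_comm _ _
  have h1 : lambdaPlus s
      = (1 - 5 * s / 3 + phiPoly s + (1 - 7 * s / 3 + phiPoly s)) / 2
        + Real.sqrt (((1 - 5 * s / 3 + phiPoly s - (1 - 7 * s / 3 + phiPoly s)) / 2) ^ 2
          + (phiPoly s - 2 * s) ^ 2) := by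
    unfold lambdaPlus
    congr 1
    · ring
    · congr 1; ring
  rw [h1]
  linarith

/-- LEMMA R, conclusion: the gradient envelope satisfies `Λ(s) < 1` for every `s > 0` — away from the origin
`|∇U_A(x)| < |A| = |∇U_A(0)|`, so the origin is the strict global maximiser of the gradient norm of the core field. -/
theorem gradEnvelope_lt_one (s : ℝ) (hs : 0 < s) : gradEnvelope s < 1 := by
  unfold gradEnvelope
  have hpos : 0 < Real.exp (-s) := Real.exp_pos _
  have hinv : Real.exp (-s) * Real.exp s = 1 := by rw [← Real.exp_add]; simp
  have hM : max (max ((1 - s / 3) ^ 2) ((1 - s) ^ 2)) (lambdaPlus s) < Real.exp s :=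
    max_lt (max_lt (channel₁_lt_exp s hs) (channel₂_lt_exp s hs)) (lambdaPlus_lt_exp s hs)
  calc Real.exp (-s) * max (max ((1 - s / 3) ^ 2) ((1 - s) ^ 2)) (lambdaPlus s)
      < Real.exp (-s) * Real.exp s := mul_lt_mul_of_pos_left hM hpos
    _ = 1 := hinv

/-- `Λ(0) = 1`: the envelope is attained at the origin (`∇U_A(0) = A`). -/
theorem gradEnvelope_zero : gradEnvelope 0 = 1 := by
  simp [gradEnvelope, lambdaPlus, phiPoly]

end Summit.NavierStokesRegularity.NavierStokesRegularity.Theorems
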